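import Summits.Ventures.Crystal3D.Theorems.StickyWulffConstantGenericWallFloorShellTrichotomy
import Summits.Ventures.Crystal3D.Theorems.StickyWulffConstantGenericWallFloorExactOnly
import Summits.Ventures.Crystal3D.Theorems.StickyWulffConstantGenericWallFloorSaturationStructure
import HarnessLib

/-!
# The per-ball TRICHOTOMY of the general-filling step: unsaturated, interior, or exact twin cap
# (crux `GenericWallFloor`, line `WallLedgerG`; cf-p1 ROUTE.md §80(9) modulo the E1 certificates)

HONEST FRAMING. Part of the venture `Summits/Ventures/Crystal3D` (cell `crystal3d-full`), helper
`--supports` the crux `GenericWallFloor` (stmt-Ventures-19480) of `route-Ventures-StickyWulffConstant`,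
registered line `WallLedgerG`, open stub `stub_twoSlabAdhesion` (THE CRUX: general fillings).  Planner cf-p1
gen 22, ROUTE §80(9): «For `u ∈ X_f` (maximal exact continuation) with CERTIFIED occupied-slot pattern:
`u` is (i) unsaturated, or (ii) interior, or (iii) capped by three foreign balls at the twin hollows.»  This
file is that statement as a theorem, in two currencies:

* **`trichotomy_of_exactOnly`** — `X` `1`-separated, `u` with grain frame `A`, own part `O ⊆ N(u)`
  EXACT-ONLY (`ExactOnly u O`: an E1 certificate, transported by `…ExactOnlyTransport`), three linearly
  independent occupied slots (`…SlotTriples`: any hemisphere pattern, any `≥ 7` slots) ⇒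
  `#N(u) ≤ 11` ∨ all twelve slots occupied ∨ EXACT TWIN CAP (unit `{111}` normal `n` of the grain; slots
  with `⟪A w, n⟫ ≤ 0` occupied, the three positive slots EMPTY, their twin images `u − A w + 2⟪A w, n⟫ n`
  occupied);
* **`slots_full_or_twinCap_of_allButOne`** — the same dichotomy for a SATURATED `u` all of whose neighbours
  but one are saturated, from `KissingGap δ` + `KissingClassification δ` BY NAME (tree-discharged at
  `δ = 5/2`) through 19480-p1's `exists_frame_of_allButOne` (…SaturationStructure) — the refinement
  «arranged dozen ⊇ non-coplanar own part ⇒ cubo or twin cap» planned in GENERAL-FILLING-ARCH;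
* `unsaturated_of_exactOnly_of_not_twin` — with an empty slot and a witness against every twin, `≤ 11`.

Ingredients: `…ShellTrichotomy` (dozen rigidity in packing currency), `…ExactOnly` (E2 interface).

WHAT THIS IS NOT: no E1 certificate, no coverage flow (E3), not the stub; rung F-C1 not moved.
-/

noncomputable section

namespace Summit.Ventures.Crystal3D.Theorems

open Summit.Ventures.Crystal3D Finset
open Literature.Geometry.DiscreteGeometry (fccKissingPattern hcpKissingPattern)
open scoped InnerProductSpace

variable {X : Finset (EuclideanSpace ℝ (Fin 3))}

/-- From a close-packed contact shell in the `IsClosePackedDozenAt` currency (E2 interface) to the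
`u + B p` currency of `…ShellTrichotomy`. -/
theorem exists_pattern_frame_of_isClosePackedDozenAt {u : EuclideanSpace ℝ (Fin 3)}
    (h : IsClosePackedDozenAt u (X.filter fun q => dist u q = 1)) :
    ∃ (P : Finset (EuclideanSpace ℝ (Fin 3))) (B : EuclideanSpace ℝ (Fin 3) →ₗᵢ[ℝ] EuclideanSpace ℝ (Fin 3)),
      (P = fccKissingPattern ∨ P = hcpKissingPattern) ∧
      (∀ p ∈ P, u + B p ∈ X) ∧ ∀ q ∈ X, dist u q = 1 → ∃ p ∈ P, q = u + B p := by
  classical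
  obtain ⟨B, hB⟩ := h
  have key : ∀ P : Finset (EuclideanSpace ℝ (Fin 3)),
      (↑(X.filter fun q => dist u q = 1) : Set (EuclideanSpace ℝ (Fin 3))) =
        (fun p => B p + u) '' (↑P : Set (EuclideanSpace ℝ (Fin 3))) →
      (∀ p ∈ P, u + B p ∈ X) ∧ ∀ q ∈ X, dist u q = 1 → ∃ p ∈ P, q = u + B p := by
    intro P hP
    constructor
    · intro p hp
      have : B p + u ∈ (↑(X.filter fun q => dist u q = 1) : Set (EuclideanSpace ℝ (Fin 3))) := by
        rw [hP]; exact ⟨p, hp, rfl⟩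
      rw [add_comm]
      exact (Finset.mem_filter.1 (Finset.mem_coe.1 this)).1
    · intro q hq hd
      have : q ∈ (↑(X.filter fun q => dist u q = 1) : Set (EuclideanSpace ℝ (Fin 3))) :=
        Finset.mem_coe.2 (Finset.mem_filter.2 ⟨hq, hd⟩)
      rw [hP] at this
      obtain ⟨p, hp, hpq⟩ := this
      exact ⟨p, hp, by rw [← hpq, add_comm]⟩
  rcases hB with hB | hB
  · exact ⟨fccKissingPattern, B, Or.inl rfl, key _ hB⟩
  · exact ⟨hcpKissingPattern, B, Or.inr rfl, key _ hB⟩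

/-- **Trichotomy under an E1 certificate (cf-p1 ROUTE §80(9)).**  In a `1`-separated configuration `X`,
let `u` be a ball with grain frame `A` whose own part `O ⊆ N(u)` is EXACT-ONLY (`ExactOnly u O`, an E1
certificate transported to `u`) and which has three linearly independent occupied slots.  Then `u` has at
most eleven contacts, OR all twelve slots `u + A w` are occupied (interior), OR `u` is an exact twin cap of
the grain (nine slots with `⟪A w, n⟫ ≤ 0` occupied, the three positive slots EMPTY, their twin images
`u − A w + 2⟪A w, n⟫ n` occupied, `n` a unit `{111}` normal of the grain). -/
theorem trichotomy_of_exactOnly (hX : ∀ p ∈ X, ∀ q ∈ X, p ≠ q → 1 ≤ dist p q)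
    (A : EuclideanSpace ℝ (Fin 3) ≃ₗᵢ[ℝ] EuclideanSpace ℝ (Fin 3)) {u : EuclideanSpace ℝ (Fin 3)}
    {O : Finset (EuclideanSpace ℝ (Fin 3))} (hOsub : O ⊆ X.filter fun q => dist u q = 1)
    (hO : ExactOnly u O)
    {w₁ w₂ w₃ : EuclideanSpace ℝ (Fin 3)} (hw₁ : w₁ ∈ fccSlots) (hw₂ : w₂ ∈ fccSlots) (hw₃ : w₃ ∈ fccSlots)
    (h₁ : u + A w₁ ∈ X) (h₂ : u + A w₂ ∈ X) (h₃ : u + A w₃ ∈ X)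
    (hind : LinearIndependent ℝ ![w₁, w₂, w₃]) :
    (X.filter fun q => dist u q = 1).card ≤ 11 ∨
    (∀ w ∈ fccSlots, u + A w ∈ X) ∨
    ∃ n : EuclideanSpace ℝ (Fin 3), ‖n‖ = 1 ∧
      (∀ w ∈ fccSlots, ⟪A w, n⟫_ℝ = 0 ∨ ⟪A w, n⟫_ℝ = Real.sqrt (2 / 3) ∨ ⟪A w, n⟫_ℝ = -Real.sqrt (2 / 3)) ∧
      (∀ w ∈ fccSlots, ⟪A w, n⟫_ℝ ≤ 0 → u + A w ∈ X) ∧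
      (∀ w ∈ fccSlots, 0 < ⟪A w, n⟫_ℝ → u + A w ∉ X ∧ u - A w + (2 * ⟪A w, n⟫_ℝ) • n ∈ X) := by
  classical
  set N := X.filter fun q => dist u q = 1 with hN
  have hkiss : IsKissingAround u N :=
    ⟨fun s hs => (Finset.mem_filter.1 hs).2,
      fun s hs t ht hst => hX s (Finset.mem_filter.1 hs).1 t (Finset.mem_filter.1 ht).1 hst⟩
  by_cases h12 : N.card = 12
  · right
    obtain ⟨P, B, hP, hmem, hshell⟩ := exists_pattern_frame_of_isClosePackedDozenAt (hO N hOsub h12 hkiss)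
    exact slots_full_or_twinCap_of_closePackedShell A B hP hmem hshell hw₁ hw₂ hw₃ h₁ h₂ h₃ hind
  · left
    have := hkiss.card_le_twelve
    omega

/-- **Trichotomy under GAP + CLASSIFICATION (all-but-one form).**  In a `1`-separated configuration `X`,
a ball `u` with twelve contacts all of whose neighbours except possibly `y₀` have twelve contacts, and with
three linearly independent occupied slots of the grain `A`, is interior (all twelve slots occupied) or an
exact twin cap of the grain.  Inputs BY NAME: `KissingGap δ`, `KissingClassification δ` (tree-discharged at
`δ = 5/2`), through `exists_frame_of_allButOne` (…SaturationStructure). -/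
theorem slots_full_or_twinCap_of_allButOne {δ : ℝ} (hg : KissingGap δ) (hc : KissingClassification δ)
    (hX : ∀ p ∈ X, ∀ q ∈ X, p ≠ q → 1 ≤ dist p q)
    (A : EuclideanSpace ℝ (Fin 3) ≃ₗᵢ[ℝ] EuclideanSpace ℝ (Fin 3)) {u : EuclideanSpace ℝ (Fin 3)}
    (h12 : (X.filter fun q => dist u q = 1).card = 12) (y₀ : EuclideanSpace ℝ (Fin 3))
    (hnb : ∀ y ∈ X, dist u y = 1 → y ≠ y₀ → (X.filter fun q => dist y q = 1).card = 12)
    {w₁ w₂ w₃ : EuclideanSpace ℝ (Fin 3)} (hw₁ : w₁ ∈ fccSlots) (hw₂ : w₂ ∈ fccSlots) (hw₃ : w₃ ∈ fccSlots)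
    (h₁ : u + A w₁ ∈ X) (h₂ : u + A w₂ ∈ X) (h₃ : u + A w₃ ∈ X)
    (hind : LinearIndependent ℝ ![w₁, w₂, w₃]) :
    (∀ w ∈ fccSlots, u + A w ∈ X) ∨
    ∃ n : EuclideanSpace ℝ (Fin 3), ‖n‖ = 1 ∧
      (∀ w ∈ fccSlots, ⟪A w, n⟫_ℝ = 0 ∨ ⟪A w, n⟫_ℝ = Real.sqrt (2 / 3) ∨ ⟪A w, n⟫_ℝ = -Real.sqrt (2 / 3)) ∧
      (∀ w ∈ fccSlots, ⟪A w, n⟫_ℝ ≤ 0 → u + A w ∈ X) ∧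
      (∀ w ∈ fccSlots, 0 < ⟪A w, n⟫_ℝ → u + A w ∉ X ∧ u - A w + (2 * ⟪A w, n⟫_ℝ) • n ∈ X) := by
  obtain ⟨P, B, hP, hmem, hshell⟩ := exists_frame_of_allButOne hg hc hX h12 y₀ hnb
  exact slots_full_or_twinCap_of_closePackedShell A B hP (fun p hp => (hmem p hp).1) hshell
    hw₁ hw₂ hw₃ h₁ h₂ h₃ hind

/-- **Unsaturated form (E1 certificate + an empty slot + no twin capping ⇒ ≤ 11 contacts).**  If moreover
some slot is empty and, for every unit `{111}` normal `n` of the grain, some slot with `⟪A w, n⟫ > 0` is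
occupied or some slot with `⟪A w, n⟫ ≤ 0` is empty (no «hexagon + polar triple» own part), then `u` has at
most eleven contacts. -/
theorem unsaturated_of_exactOnly_of_not_twin (hX : ∀ p ∈ X, ∀ q ∈ X, p ≠ q → 1 ≤ dist p q)
    (A : EuclideanSpace ℝ (Fin 3) ≃ₗᵢ[ℝ] EuclideanSpace ℝ (Fin 3)) {u : EuclideanSpace ℝ (Fin 3)}
    {O : Finset (EuclideanSpace ℝ (Fin 3))} (hOsub : O ⊆ X.filter fun q => dist u q = 1)
    (hO : ExactOnly u O)
    {w₁ w₂ w₃ : EuclideanSpace ℝ (Fin 3)} (hw₁ : w₁ ∈ fccSlots) (hw₂ : w₂ ∈ fccSlots) (hw₃ : w₃ ∈ fccSlots)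
    (h₁ : u + A w₁ ∈ X) (h₂ : u + A w₂ ∈ X) (h₃ : u + A w₃ ∈ X)
    (hind : LinearIndependent ℝ ![w₁, w₂, w₃])
    (hv : ∃ v ∈ fccSlots, u + A v ∉ X)
    (hnot : ∀ n : EuclideanSpace ℝ (Fin 3), ‖n‖ = 1 →
      (∀ w ∈ fccSlots, ⟪A w, n⟫_ℝ = 0 ∨ ⟪A w, n⟫_ℝ = Real.sqrt (2 / 3) ∨ ⟪A w, n⟫_ℝ = -Real.sqrt (2 / 3)) →
      (∃ w ∈ fccSlots, 0 < ⟪A w, n⟫_ℝ ∧ u + A w ∈ X) ∨ (∃ w ∈ fccSlots, ⟪A w, n⟫_ℝ ≤ 0 ∧ u + A w ∉ X)) :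
    (X.filter fun q => dist u q = 1).card ≤ 11 := by
  rcases trichotomy_of_exactOnly hX A hOsub hO hw₁ hw₂ hw₃ h₁ h₂ h₃ hind with h | h | ⟨n, hn1, hmenu, hle, hgt⟩
  · exact h
  · obtain ⟨v, hv, hvX⟩ := hv
    exact absurd (h v hv) hvX
  · rcases hnot n hn1 hmenu with ⟨w, hw, hpos, hwX⟩ | ⟨w, hw, hnp, hwX⟩
    · exact absurd hwX (hgt w hw hpos).1
    · exact absurd (hle w hw hnp) hwX

end Summit.Ventures.Crystal3D.Theorems

end
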